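import Summits.Ventures.FusionMHD.Models.SolovevMercierProfileKernels
import Literature.Analysis.ValidatedNumerics.TaylorModelPanelOps
import HarnessLib

/-!
# The margin polynomial of the whole-profile Mercier lane: branch sums `T_i(s)`, `N₂`/`N₀` in T-form, the univariate margin
# Taylor model, and the MASTER CERTIFICATE THEOREM `margin_pos_of_cert`

Venture LADDER-GRIDFUSION, rung F1.MERCIER-profile («F1.MERCIER-WHOLE-PROFILE»; cell `gridfusion`, seat gridfusion-sos-6 (g6),
2026-08-27).  Sequel of `Models/SolovevMercierProfileKernels.lean` (the eight substituted kernels `ker I σ i s v` and the vector box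
rule `kerBox` with its soundness `kerBox_sound`) and of `Literature/Analysis/ValidatedNumerics/TaylorModelIntegralCertStrip.lean`
(piecewise-certified strips `tmem_pieces`, `sumPieces`).

* `measurable_ker`; `brInt I σ i s = ∫₀¹ ker`, the branch sums `Tint I i s` (`2·Σ_σ` for the `[0, 2π]` integrals, `Σ_σ` for `D₅`);
* `slopeT I κ₁ C_s s`, `interceptT I κ₁ C_s s` — gridfusion-model-7's axis-regular `N₂`, `N₀` (`Models/SolovevMercierAxisRegular`)
  written in the `T_i` with RATIONAL coefficients (`D₅ = −5R₀T₇`, `D₃ = −3R₀T₆`, `I_X = (2/R₀)T₄`, `I_Y = 4T₅`, `k = κ₁R₀`,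
  `r = s·ε/R₀`, `R₀² = u0`; the identification is `Models/SolovevMercierProfileIdent.lean`);
* `sumT`, `margTM` (the univariate Taylor model of `G²·slopeT − interceptT` in `ρ = s − cx` from the certified piece lists) with
  `tmem_sumT`, `tmem_margTM`;
* **`margin_pos_of_cert`**: pieces tiling `v ∈ [0, 1]` per branch, one kernel equality per piece against a literal, and a positive
  lower range bound of the margin model ⇒ `∀ |ρ| ≤ h, 0 < G²·slopeT(cx + ρ) − interceptT(cx + ρ)`.
HONEST FRAMING: kernel-arithmetic plumbing about MODEL objects; no enclosure is claimed here; nothing about a device.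
-/

open Literature.Analysis.ValidatedNumerics Literature.Analysis.ValidatedNumerics.PolyMP
open Literature.Analysis.ValidatedNumerics.NumericsMP

namespace Summit.Ventures.FusionMHD.Models.LcMercierProfile

/-- Joint measurability of every kernel (products of `√·`, `(·)⁻¹` and polynomials). [folklore] -/
theorem measurable_ker (I : KInst) (σ : ℚ) (i : ℕ) : Measurable fun z : ℝ × ℝ => ker I σ i z.1 z.2 := by
  have hcw : Measurable fun z : ℝ × ℝ => cw σ z.2 := by unfold cw ip; fun_prop
  have hs2 : Measurable fun z : ℝ × ℝ => s2w z.2 := by unfold s2w ip; fun_prop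
  have hj : Measurable fun z : ℝ × ℝ => jac z.2 := by unfold jac ip; fun_prop
  have hu : Measurable fun z : ℝ × ℝ => uu I σ z.1 z.2 := by
    unfold uu; exact measurable_const.add (measurable_const.mul (measurable_fst.mul hcw))
  have hisu : Measurable fun z : ℝ × ℝ => isu I σ z.1 z.2 := by
    unfold isu; exact (Real.continuous_sqrt.measurable.comp hu).inv
  have hiu : Measurable fun z : ℝ × ℝ => iu I σ z.1 z.2 := by unfold iu; exact hisu.mul hisu
  have haa : Measurable fun z : ℝ × ℝ => aa I σ z.1 z.2 := by
    unfold aa; exact (hu.mul hcw).add (measurable_const.mul (measurable_fst.mul hs2))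
  have hq : Measurable fun z : ℝ × ℝ => qq I σ z.1 z.2 := by
    unfold qq; exact (measurable_const.mul (hu.mul hs2)).add (hiu.mul (haa.mul haa))
  have hiq : Measurable fun z : ℝ × ℝ => (qq I σ z.1 z.2)⁻¹ := hq.inv
  unfold ker
  rcases i with _ | _ | _ | _ | _ | _ | _ | _ | _
  · exact (hisu.mul hj).mul hiu
  · exact (hisu.mul hj).mul hiq
  · exact ((hisu.mul hj).mul hiq).mul hiu
  · exact ((hisu.mul hj).mul hiq).mul hu
  · exact ((hisu.mul hj).mul hiq).mul hcw
  · exact (((hisu.mul hj).mul hiq).mul hiu).mul (hcw.mul hcw)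
  · exact (((hisu.mul hj).mul hiu).mul hiu).mul hs2
  · exact ((((hisu.mul hj).mul hiu).mul hiu).mul hiu).mul hs2
  · exact measurable_const

/-- The substituted branch integral `∫₀¹ ker_i(σ; s, v) dv`. [folklore] -/
noncomputable def brInt (I : KInst) (σ : ℚ) (i : ℕ) (s : ℝ) : ℝ := ∫ v in (0 : ℝ)..1, ker I σ i s v

/-- `T_i(s)`: the branch-summed substituted integrals — `2·(∫₀¹ker_i(+1) + ∫₀¹ker_i(−1))` for `i ≠ 7` (a `[0, 2π]` loop
integral folded to `2×[0, π]` and split at `t = π/2`), `∫₀¹ker_7(+1) + ∫₀¹ker_7(−1)` for `i = 7` (`D₅`'s `[0, π]`).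
[cite: Jardin2010, §8.5.4 eq. (8.134)] -/
noncomputable def Tint (I : KInst) (i : ℕ) (s : ℝ) : ℝ :=
  (if i = 7 then 1 else 2) * (brInt I 1 i s + brInt I (-1) i s)

/-- `N₂` IN T-FORM: with `D₅ = −5R₀T₇`, `D₃ = −3R₀T₆`, `I_X = (2/R₀)T₄`, `I_Y = 4T₅`, `I₆ = T₁`, `I₇ = T₂`, `I₈ = T₃`, `k = κ₁R₀`,
`r = s·ε/R₀`, `R₀² = u0`, model-7's `N₂ = 9r²k²D₅² − 6C_skD₅I₆ + C_s²(I_X² − I₈I_Y/R₀²) + C_skI₇D₃` reads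
`225κ₁²u0ε²s²T₇² + 30C_sκ₁u0·T₁T₇ + (4C_s²/u0)(T₄² − T₃T₅) − 3C_sκ₁u0·T₂T₆` — RATIONAL coefficients only.
[cite: Jardin2010, §8.5.4 eq. (8.134)] -/
noncomputable def slopeT (I : KInst) (kap1 cs : ℚ) (s : ℝ) : ℝ :=
  ((225 * kap1 ^ 2 * I.u0 * I.eps ^ 2 : ℚ) : ℝ) * s ^ 2 * Tint I 7 s ^ 2
    + ((30 * cs * kap1 * I.u0 : ℚ) : ℝ) * (Tint I 1 s * Tint I 7 s)
    + ((4 * cs ^ 2 / I.u0 : ℚ) : ℝ) * (Tint I 4 s ^ 2 - Tint I 3 s * Tint I 5 s)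
    + ((-3 * cs * kap1 * I.u0 : ℚ) : ℝ) * (Tint I 2 s * Tint I 6 s)

/-- `N₀` IN T-FORM: `N₀ = C_s²k²I_BI₈ − C_sk³r²I_BD₃ = C_s²κ₁²u0·T₀T₃ + 3C_sκ₁³u0ε²s²·T₀T₆`. [cite: Jardin2010, §8.5.4 eq. (8.134)] -/
noncomputable def interceptT (I : KInst) (kap1 cs : ℚ) (s : ℝ) : ℝ :=
  ((cs ^ 2 * kap1 ^ 2 * I.u0 : ℚ) : ℝ) * (Tint I 0 s * Tint I 3 s)
    + ((3 * cs * kap1 ^ 3 * I.u0 * I.eps ^ 2 : ℚ) : ℝ) * s ^ 2 * (Tint I 0 s * Tint I 6 s)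

/-- The branch sum of the certified integral models: `T_i` from the branch-`+1` list `P` and the branch-`−1` list `M`
(each the component-wise sum of its pieces over `v ∈ [0, 1]`). [cite: MakinoBerz2003, Algorithm 2] -/
def sumT (P M : List IPoly) (i : ℕ) : IPoly :=
  let B := taddI (P.getD i []) (M.getD i [])
  if i = 7 then B else tsmulInt 2 B

/-- THE MARGIN MODEL: the univariate Taylor model in `ρ = s − cx` of `G²·N₂ − N₀` in T-form, from the branch lists
(products truncated at degree `D`; every coefficient a rational literal). [cite: MakinoBerz2003, Definition 2] -/
def margTM (S : ℕ) (h : ℚ) (D : ℕ) (I : KInst) (kap1 cs G2 cx : ℚ) (P M : List IPoly) : IPoly :=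
  let T := sumT P M
  let sv := tvar S (ofRat S cx)
  let s2 := tmulI S h D sv sv
  let N2 :=
    taddI (taddI (taddI
      (tsmulI S (ofRat S (225 * kap1 ^ 2 * I.u0 * I.eps ^ 2)) (tmulI S h D s2 (tmulI S h D (T 7) (T 7))))
      (tsmulI S (ofRat S (30 * cs * kap1 * I.u0)) (tmulI S h D (T 1) (T 7))))
      (tsmulI S (ofRat S (4 * cs ^ 2 / I.u0)) (tsubI (tmulI S h D (T 4) (T 4)) (tmulI S h D (T 3) (T 5)))))
      (tsmulI S (ofRat S (-3 * cs * kap1 * I.u0)) (tmulI S h D (T 2) (T 6)))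
  let N0 :=
    taddI (tsmulI S (ofRat S (cs ^ 2 * kap1 ^ 2 * I.u0)) (tmulI S h D (T 0) (T 3)))
      (tsmulI S (ofRat S (3 * cs * kap1 ^ 3 * I.u0 * I.eps ^ 2)) (tmulI S h D s2 (tmulI S h D (T 0) (T 6))))
  tsubI (tsmulI S (ofRat S G2) N2) N0

/-- Soundness of the branch sum. [cite: MakinoBerz2003, Algorithm 2] -/
theorem tmem_sumT {S : ℕ} {h : ℚ} {I : KInst} {cx : ℚ} {P M : List IPoly}
    (hP : ∀ i : ℕ, i < 8 → TMem S h (fun ρ => ∫ v in ((0 : ℚ) : ℝ)..((1 : ℚ) : ℝ), ker I 1 i ((cx : ℝ) + ρ) v) (P.getD i []))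
    (hM : ∀ i : ℕ, i < 8 → TMem S h (fun ρ => ∫ v in ((0 : ℚ) : ℝ)..((1 : ℚ) : ℝ), ker I (-1) i ((cx : ℝ) + ρ) v) (M.getD i []))
    {i : ℕ} (hi : i < 8) : TMem S h (fun ρ => Tint I i ((cx : ℝ) + ρ)) (sumT P M i) := by
  have hB : TMem S h (fun ρ => brInt I 1 i ((cx : ℝ) + ρ) + brInt I (-1) i ((cx : ℝ) + ρ))
      (taddI (P.getD i []) (M.getD i [])) := by
    have := tmem_add (hP i hi) (hM i hi)
    simpa [brInt] using this
  unfold sumT Tint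
  by_cases h7 : i = 7
  · simp only [h7, if_true, one_mul]
    simpa [h7] using hB
  · simp only [h7, if_false]
    have := tmem_smulInt 2 hB
    refine fun ρ hρ => ?_
    obtain ⟨as, has, e⟩ := this ρ hρ
    exact ⟨as, has, by rw [← e]; push_cast; ring⟩

/-- Soundness of the margin model. [cite: MakinoBerz2003, Definition 2] -/
theorem tmem_margTM {S : ℕ} (hS : 0 < S) {h : ℚ} (h0 : 0 ≤ h) (D : ℕ) (I : KInst) (kap1 cs G2 cx : ℚ)
    {P M : List IPoly} (hT : ∀ i : ℕ, i < 8 → TMem S h (fun ρ => Tint I i ((cx : ℝ) + ρ)) (sumT P M i)) :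
    TMem S h (fun ρ => ((G2 : ℚ) : ℝ) * slopeT I kap1 cs ((cx : ℝ) + ρ) - interceptT I kap1 cs ((cx : ℝ) + ρ))
      (margTM S h D I kap1 cs G2 cx P M) := by
  have hsv : TMem S h (fun ρ => (cx : ℝ) + ρ) (tvar S (ofRat S cx)) := tmem_var (mem_ofRat S cx)
  have hs2 := tmem_mul hS h0 D hsv hsv
  have h0' := hT 0 (by norm_num); have h1 := hT 1 (by norm_num); have h2 := hT 2 (by norm_num)
  have h3 := hT 3 (by norm_num); have h4 := hT 4 (by norm_num); have h5 := hT 5 (by norm_num)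
  have h6 := hT 6 (by norm_num); have h7 := hT 7 (by norm_num)
  have hN2 := tmem_add (tmem_add (tmem_add
    (tmem_smulI hS (h := h) (mem_ofRat S (225 * kap1 ^ 2 * I.u0 * I.eps ^ 2)) (tmem_mul hS h0 D hs2 (tmem_mul hS h0 D h7 h7)))
    (tmem_smulI hS (h := h) (mem_ofRat S (30 * cs * kap1 * I.u0)) (tmem_mul hS h0 D h1 h7)))
    (tmem_smulI hS (h := h) (mem_ofRat S (4 * cs ^ 2 / I.u0)) (tmem_sub (tmem_mul hS h0 D h4 h4) (tmem_mul hS h0 D h3 h5))))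
    (tmem_smulI hS (h := h) (mem_ofRat S (-3 * cs * kap1 * I.u0)) (tmem_mul hS h0 D h2 h6))
  have hN0 := tmem_add
    (tmem_smulI hS (h := h) (mem_ofRat S (cs ^ 2 * kap1 ^ 2 * I.u0)) (tmem_mul hS h0 D h0' h3))
    (tmem_smulI hS (h := h) (mem_ofRat S (3 * cs * kap1 ^ 3 * I.u0 * I.eps ^ 2))
      (tmem_mul hS h0 D hs2 (tmem_mul hS h0 D h0' h6)))
  have hMg := tmem_sub (tmem_smulI hS (h := h) (mem_ofRat S G2) hN2) hN0
  refine fun ρ hρ => ?_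
  obtain ⟨as, has, e⟩ := hMg ρ hρ
  refine ⟨as, ?_, ?_⟩
  · simpa [margTM] using has
  · rw [← e]; simp only [slopeT, interceptT]; ring

/-- **THE MASTER CERTIFICATE THEOREM.**  For an `s`-panel `|s − cx| ≤ h` of instance `I`: suppose the `v`-interval `[0, 1]` of each
branch is tiled by consecutive PIECES (`piecesOK 0 starts kss 1`; branch `+1`: `startsP, kssP`, branch `−1`: `startsM, kssM`), every
piece's vector strip model evaluates — IN THE KERNEL, one `decide` per piece — to a literal model list with all flags accepted
(`litsP[j]`, `litsM[j]`), and the margin model built from the component-wise sums has positive lower range bound; then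
`G²·N₂(s) − N₀(s) > 0` in T-form for every `s` of the panel. [cite: MakinoBerz2003, Algorithm 2]
[cite: MahboubiMelquiondSibutpinote2016, Sect. 3.3] -/
theorem margin_pos_of_cert {S : ℕ} (hS : 0 < S) {P : EPrm} {h cx : ℚ} (h0 : 0 ≤ h) {I : KInst}
    {startsP : List ℚ} {kssP : List (List ℚ)} {litsP : List (List IPoly)}
    {startsM : List ℚ} {kssM : List (List ℚ)} {litsM : List (List IPoly)}
    (hokP : piecesOK 0 startsP kssP 1 = true) (hlenP : litsP.length = kssP.length)
    (hokM : piecesOK 0 startsM kssM 1 = true) (hlenM : litsM.length = kssM.length)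
    (hP : ∀ j : ℕ, j < kssP.length →
      stripTMs S h 8 (kerBox S P h cx I 1) (startsP.getD j 0) (kssP.getD j []) = (litsP.getD j [], true))
    (hM : ∀ j : ℕ, j < kssM.length →
      stripTMs S h 8 (kerBox S P h cx I (-1)) (startsM.getD j 0) (kssM.getD j []) = (litsM.getD j [], true))
    {D : ℕ} {kap1 cs G2 : ℚ} (hpos : 0 < tlowerI S h (margTM S h D I kap1 cs G2 cx (sumPieces 8 litsP) (sumPieces 8 litsM))) :
    ∀ ρ : ℝ, |ρ| ≤ h → 0 < ((G2 : ℚ) : ℝ) * slopeT I kap1 cs ((cx : ℝ) + ρ) - interceptT I kap1 cs ((cx : ℝ) + ρ) := by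
  have hmp : ∀ i : ℕ, i < 8 → Measurable fun z : ℝ × ℝ => ker I 1 i ((cx : ℝ) + z.1) z.2 := fun i _ =>
    (measurable_ker I 1 i).comp ((measurable_fst.const_add (cx : ℝ)).prodMk measurable_snd)
  have hmm : ∀ i : ℕ, i < 8 → Measurable fun z : ℝ × ℝ => ker I (-1) i ((cx : ℝ) + z.1) z.2 := fun i _ =>
    (measurable_ker I (-1) i).comp ((measurable_fst.const_add (cx : ℝ)).prodMk measurable_snd)
  have sP := tmem_pieces hS h0 hmp (kerBox_sound hS P h0 cx I 1) startsP kssP litsP 0 1 hokP hlenP hP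
  have sM := tmem_pieces hS h0 hmm (kerBox_sound hS P h0 cx I (-1)) startsM kssM litsM 0 1 hokM hlenM hM
  have hT : ∀ i : ℕ, i < 8 → TMem S h (fun ρ => Tint I i ((cx : ℝ) + ρ)) (sumT (sumPieces 8 litsP) (sumPieces 8 litsM) i) :=
    fun i hi => tmem_sumT (fun i hi => (sP i hi).1) (fun i hi => (sM i hi).1) hi
  have hmarg := tmem_margTM hS h0 D I kap1 cs G2 cx hT
  intro ρ hρ
  have hlo := tlowerI_le h0 hmarg hρ
  have hposR : (0 : ℝ) < (tlowerI S h (margTM S h D I kap1 cs G2 cx (sumPieces 8 litsP) (sumPieces 8 litsM)) : ℝ) := by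
    exact_mod_cast hpos
  have hSr : (0 : ℝ) < S := by exact_mod_cast hS
  nlinarith

/-! ## §A (appended) Sharper range read-back on re-centred SUB-PANELS of the margin model

`margin_pos_of_cert` reads the margin model by the naive bound `tlowerI` (`c₀.lo − Σ|c_k|h^k`), which charges the whole VARIATION
of the margin across the panel against its minimum.  With the tree's re-centring `shiftI` / `tmem_shiftI`
(`Literature/Analysis/ValidatedNumerics/TaylorModelPanelOps.lean`) the SAME model is read on consecutive sub-panels
`[m_j − w_j, m_j + w_j]` covering `[−h, h]`, each by `tlowerI` of the shifted polynomial — no new box, no new kernel equality. -/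

/-- The sub-panels `(m_j, w_j)` are consecutive from `x` and end at `h`: `m₀ − w₀ = x`, `m_j + w_j = m_{j+1} − w_{j+1}`, last
`m + w = h`; every `w_j ≥ 0`. [folklore] -/
def subsCover (h : ℚ) : ℚ → List (ℚ × ℚ) → Bool
  | x, [] => decide (x = h)
  | x, (m, w) :: rest => decide (m - w = x) && decide (0 ≤ w) && subsCover h (m + w) rest

/-- Every shifted model has positive (naive) lower range bound on its own sub-panel. [cite: MakinoBerz2003, Definition 1] -/
def subpanelsPos (S : ℕ) (P : IPoly) (subs : List (ℚ × ℚ)) : Bool :=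
  subs.all fun mw => decide (0 < tlowerI S mw.2 (shiftI S P (ofRat S mw.1)))

/-- A cover starting at `x` ends at `h`, so `x ≤ h`. [folklore] -/
theorem le_of_subsCover (h : ℚ) : ∀ (subs : List (ℚ × ℚ)) (x : ℚ), subsCover h x subs = true → x ≤ h
  | [], x, hc => by simp only [subsCover, decide_eq_true_eq] at hc; exact hc.le
  | (m, w) :: rest, x, hc => by
      simp only [subsCover, Bool.and_eq_true, decide_eq_true_eq] at hc
      have h1 := le_of_subsCover h rest (m + w) hc.2
      linarith [hc.1.1, hc.1.2]

/-- One sub-panel: from the model on `|ρ| ≤ h`, `m − w ≥ −h`, `m + w ≤ h`, `0 ≤ w` and a positive shifted lower bound, `0 < f ρ` for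
`|ρ − m| ≤ w`. [cite: MakinoBerz2003, Definition 1] -/
theorem pos_on_subpanel {S : ℕ} (hS : 0 < S) {h : ℚ} {f : ℝ → ℝ} {P : IPoly} (hf : TMem S h f P) {m w : ℚ}
    (hl : -h ≤ m - w) (hr : m + w ≤ h) (hw : 0 ≤ w) (hp : 0 < tlowerI S w (shiftI S P (ofRat S m)))
    {ρ : ℝ} (hρ : |ρ - m| ≤ w) : 0 < f ρ := by
  have hrad : ((w : ℚ) : ℝ) + |((m : ℚ) : ℝ)| ≤ h := by
    rcases le_or_gt 0 ((m : ℚ) : ℝ) with hm0 | hm0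
    · rw [abs_of_nonneg hm0]; exact_mod_cast (by linarith : w + m ≤ h)
    · rw [abs_of_neg hm0]
      have : ((w - m : ℚ) : ℝ) ≤ h := by exact_mod_cast (by linarith : w - m ≤ h)
      push_cast at this; linarith
  have hT := tmem_shiftI hS hf (mem_ofRat S m) hrad
  have hlo := tlowerI_le (by exact_mod_cast hw) hT hρ
  have hposR : (0 : ℝ) < (tlowerI S w (shiftI S P (ofRat S m)) : ℝ) := by exact_mod_cast hp
  have hSr : (0 : ℝ) < S := by exact_mod_cast hS
  have e : ((m : ℚ) : ℝ) + (ρ - m) = ρ := by ring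
  rw [e] at hlo
  nlinarith

/-- Induction over a cover starting at `x ≥ −h`: `0 < f` on `[x, h]`. [cite: MakinoBerz2003, Definition 1] -/
theorem pos_of_subpanels_from {S : ℕ} (hS : 0 < S) {h : ℚ} {f : ℝ → ℝ} {P : IPoly} (hf : TMem S h f P) :
    ∀ (subs : List (ℚ × ℚ)) (x : ℚ), subs ≠ [] → -h ≤ x → subsCover h x subs = true → subpanelsPos S P subs = true →
      ∀ ρ : ℝ, (x : ℝ) ≤ ρ → ρ ≤ h → 0 < f ρ
  | [], _, hne, _, _, _, _, _, _ => absurd rfl hne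
  | (m, w) :: rest, x, _, hx, hc, hp, ρ, h1, h2 => by
      simp only [subsCover, Bool.and_eq_true, decide_eq_true_eq] at hc
      obtain ⟨⟨hm, hw⟩, hrest⟩ := hc
      simp only [subpanelsPos, List.all_cons, Bool.and_eq_true, decide_eq_true_eq] at hp
      have hend : m + w ≤ h := le_of_subsCover h rest (m + w) hrest
      by_cases hρ : ρ ≤ (m : ℝ) + w
      · refine pos_on_subpanel hS hf (m := m) (w := w) (by linarith) hend hw hp.1 ?_
        have : ((m : ℚ) : ℝ) - w = x := by exact_mod_cast hm
        rw [abs_le]; constructor <;> linarith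
      · push Not at hρ
        by_cases hnil : rest = []
        · -- no further sub-panel: then m + w = h and ρ > h, contradiction
          subst hnil
          simp only [subsCover, decide_eq_true_eq] at hrest
          have : ((m : ℚ) : ℝ) + w = h := by exact_mod_cast hrest
          linarith
        · exact pos_of_subpanels_from hS hf rest (m + w) hnil (by linarith) hrest
            (by simpa [subpanelsPos] using hp.2) ρ (by push_cast; exact hρ.le) h2

/-- **Sub-panel read-back**: a Taylor model of `f` on `|ρ| ≤ h`, a nonempty consecutive cover of `[−h, h]`, and positive shifted
lower bounds give `0 < f ρ` for every `|ρ| ≤ h`. [cite: MakinoBerz2003, Definition 1] -/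
theorem pos_of_subpanels {S : ℕ} (hS : 0 < S) {h : ℚ} {f : ℝ → ℝ} {P : IPoly} (hf : TMem S h f P)
    {subs : List (ℚ × ℚ)} (hne : subs ≠ []) (hc : subsCover h (-h) subs = true) (hp : subpanelsPos S P subs = true) :
    ∀ ρ : ℝ, |ρ| ≤ h → 0 < f ρ := fun ρ hρ =>
  pos_of_subpanels_from hS hf subs (-h) hne le_rfl hc hp ρ (by push_cast; exact (abs_le.mp hρ).1) (abs_le.mp hρ).2

/-- **MASTER CERTIFICATE THEOREM, sub-panel form**: as `margin_pos_of_cert`, with the final read-back on a nonempty consecutive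
cover `subs` of `[−h, h]` (each sub-panel's shifted margin model checked by `tlowerI`). [cite: MakinoBerz2003, Algorithm 2]
[cite: MahboubiMelquiondSibutpinote2016, Sect. 3.3] -/
theorem margin_pos_of_cert_subs {S : ℕ} (hS : 0 < S) {P : EPrm} {h cx : ℚ} (h0 : 0 ≤ h) {I : KInst}
    {startsP : List ℚ} {kssP : List (List ℚ)} {litsP : List (List IPoly)}
    {startsM : List ℚ} {kssM : List (List ℚ)} {litsM : List (List IPoly)}
    (hokP : piecesOK 0 startsP kssP 1 = true) (hlenP : litsP.length = kssP.length)
    (hokM : piecesOK 0 startsM kssM 1 = true) (hlenM : litsM.length = kssM.length)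
    (hP : ∀ j : ℕ, j < kssP.length →
      stripTMs S h 8 (kerBox S P h cx I 1) (startsP.getD j 0) (kssP.getD j []) = (litsP.getD j [], true))
    (hM : ∀ j : ℕ, j < kssM.length →
      stripTMs S h 8 (kerBox S P h cx I (-1)) (startsM.getD j 0) (kssM.getD j []) = (litsM.getD j [], true))
    {D : ℕ} {kap1 cs G2 : ℚ} {subs : List (ℚ × ℚ)} (hne : subs ≠ []) (hcov : subsCover h (-h) subs = true)
    (hpos : subpanelsPos S (margTM S h D I kap1 cs G2 cx (sumPieces 8 litsP) (sumPieces 8 litsM)) subs = true) :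
    ∀ ρ : ℝ, |ρ| ≤ h → 0 < ((G2 : ℚ) : ℝ) * slopeT I kap1 cs ((cx : ℝ) + ρ) - interceptT I kap1 cs ((cx : ℝ) + ρ) := by
  have hmp : ∀ i : ℕ, i < 8 → Measurable fun z : ℝ × ℝ => ker I 1 i ((cx : ℝ) + z.1) z.2 := fun i _ =>
    (measurable_ker I 1 i).comp ((measurable_fst.const_add (cx : ℝ)).prodMk measurable_snd)
  have hmm : ∀ i : ℕ, i < 8 → Measurable fun z : ℝ × ℝ => ker I (-1) i ((cx : ℝ) + z.1) z.2 := fun i _ =>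
    (measurable_ker I (-1) i).comp ((measurable_fst.const_add (cx : ℝ)).prodMk measurable_snd)
  have sP := tmem_pieces hS h0 hmp (kerBox_sound hS P h0 cx I 1) startsP kssP litsP 0 1 hokP hlenP hP
  have sM := tmem_pieces hS h0 hmm (kerBox_sound hS P h0 cx I (-1)) startsM kssM litsM 0 1 hokM hlenM hM
  have hT : ∀ i : ℕ, i < 8 → TMem S h (fun ρ => Tint I i ((cx : ℝ) + ρ)) (sumT (sumPieces 8 litsP) (sumPieces 8 litsM) i) :=
    fun i hi => tmem_sumT (fun i hi => (sP i hi).1) (fun i hi => (sM i hi).1) hi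
  exact pos_of_subpanels hS (tmem_margTM hS h0 D I kap1 cs G2 cx hT) hne hcov hpos

end Summit.Ventures.FusionMHD.Models.LcMercierProfile
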